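import Summits.QuantumFields.YangMills.Theorems.BalabanUVNodesN15DefectKernel
import HarnessLib

/-!
# Route «BalabanUVNodes», node N15 = NE2, road (c) — PROGRAMME (P-S), II: SHARP-BLOCK ROWS OF MATRICES — entries ⟺ block majorants for `Matrix.mulVecLin` (SHARP in both
# directions), rows of the TRANSPOSED PRODUCTS `Aᵀ·B` (coarse ← coarse) and `A·C·Bᵀ` (fine ← fine) from the rows of kernels `A, B : fine ← coarse`, `C : coarse ← coarse`,
# their exponential-kernel corollaries, and compositions with block-LOCAL factors (dag-n15-c g23, n15-c∕213; generic bookkeeping for n15-c∕214)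

Cell `pub-ymgap`, seat `pub-ymgap-dag-n15-c` (generation g23; R134 (a), s1; HUMAN RULING D-0062; chair R424 venue).  `bears_on: R4∕N15 · K3⁸ SpineGivenEndpointR13SepCoPHV
(stmt-QuantumFields-27366)`; filed `--supports stmt-QuantumFields-27366 --as helper` — COUNT-NEUTRAL.  Generic finite bookkeeping ([folklore]); theorems only, 0 `def`, 0 `sorry`;
NO estimate of Bałaban's.  Imports BY NAME this seat's n15-c part 1 `…N15DefectKernel` (`hasMaj_ofBlocks_of_rowSum`, `entry_le_of_hasMaj`; through it `B11SectG` (`BlockNorm`, `HasMaj`,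
`hasMaj_comp`, `RowSum`, `conv_exp_le`), `B11AxialTransport190` (`abs_le_loc_ofBlocks`, `loc_ofBlocks_le`), `T4EtaRateCoeffDefect.fibre`).  Nothing in the tree is modified.

WHY.  n15-c∕212 factorises Bałaban's Landau summand as `D(I−R)Dᵀ = E·(Q′G′²Q′ᵀ)⁻¹·Eᵀ` with `E = DG′Q′ᵀ : fine 1-forms ← coarse scalars` ([Balaban1985BackgroundPropagators] p. 399,
(3.49) from Thms 3.1–3.2 «using again Lemma 2.1»).  The sup-norm block rows of such words are NOT compositions of three `HasMaj` rows (the transposed factor `Eᵀ` is read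
through COLUMN sums), but they follow from the rows of `E` alone because a coarse source pairs with a WHOLE fine block: `Σ_{p′ ∈ B(z′)} |E(p′, y′)| ≤ #B(z′)·K_E(z′, y′)`.
THIS FILE proves that device once, for arbitrary real matrices between lattices with sharp block maps.

RESULTS ([folklore]; `ofBlocks` = `B11SectG.BlockNorm.ofBlocks`, the sharp-cube sup size).
* §1 `mulVecLin_single_apply`; `entry_le_of_hasMaj_mulVecLin` (`|A x₂ z| ≤ K(blk₂x₂, blk₁z)`); ★ `sum_abs_le_of_hasMaj_mulVecLin` — THE SHARP CONVERSE: a block majorant `K ≥ 0` of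
  `A.mulVecLin` bounds the block ROW SUMS `Σ_{z ∈ blk₁⁻¹y′} |A x₂ z| ≤ K(blk₂ x₂, y′)` (test against the sign pattern of the row, not a point mass); `hasMaj_mulVecLin_of_sum_abs_le`
  (the converse, = part 1's `hasMaj_ofBlocks_of_rowSum`); `sum_fibre_abs_le_card_mul` (COLUMN block sums `≤ #blk₂⁻¹z′ · K`).
* §2 ★ `hasMaj_transpose_mul` — rows of `Aᵀ·B` (`A, B : Matrix P Y`, rows `K_A, K_B` as maps coarse `Y` → fine `P`, fine blocks of cardinality `≤ N`):
  `(w, w′) ↦ N·Σ_z K_A(z, w)·K_B(z, w′)`; ★★ **`hasMaj_mul_mul_transpose`** — rows of `A·C·Bᵀ` (fine → fine): `(z, z′) ↦ N·N_Y²·Σ_{w,w′} K_A(z,w)·K_C(w,w′)·K_B(z′,w′)`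
  (`N_Y` = coarse block cardinality, e.g. the number of colours).
* §3 exponential kernels (any geometry with (2.54), `d ≥ 0`, `d` symmetric, and the row sum (2.61) at rate `σ` with constant `c`): `hasMaj_transpose_mul_exp`
  (`N·a·b·c·e^{−(δ−σ)d}`), ★★ `hasMaj_mul_mul_transpose_exp` (`N·N_Y²·a·γ·b·c²·e^{−(δ−σ)d}` for rows `a e^{−δd}`, `γ e^{−δd}`, `b e^{−δd}`, `0 < σ ≤ δ`).
* §4 `hasMaj_comp_localRight` ∕ `hasMaj_comp_localLeft` — composition with a factor whose majorant is supported on the block diagonal (`𝟙[y = y′]·m`): no row sum, no rate loss;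
  `indicator_le_exp` (`𝟙[y = y′]·m ≤ m·e^{−ρ d(y,y′)}` when `d(y,y) = 0`).

HONEST FRAMING ∕ LIMITS.  Bookkeeping only; nothing of [Balaban1985BackgroundPropagators] asserted ((3.49) p. 399 and [Balaban1984PropagatorsII] (2.52)–(2.56) pp. 232–233 are the
SHAPES served); NE2⁺ NOT PRINTED; N15 of record untouched (DISCHARGED AS CONSUMED, p687738); counts UNMOVED (typed 28∕28 · discharged 8∕27); nothing continuum ∕ OS ∕ mass gap ∕ Clay.
Restate-immune (no Theses import).
-/

noncomputable section

open scoped BigOperators Matrix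
open Finset

namespace Summit.QuantumFields.YangMills.BalabanUVNodes.N15.BlockRows

open Literature.MathematicalPhysics.QuantumFieldTheory.Balaban1983to89
open Literature.MathematicalPhysics.QuantumFieldTheory.Balaban1983to89.B11SectG (BlockNorm HasMaj hasMaj_comp RowSum conv_exp_le)
open Literature.MathematicalPhysics.QuantumFieldTheory.Balaban1983to89.B6RandomWalk (Triangle254)
open Literature.MathematicalPhysics.QuantumFieldTheory.Balaban1983to89.B11AxialTransport190 (abs_le_loc_ofBlocks loc_ofBlocks_le)
open Literature.MathematicalPhysics.QuantumFieldTheory.Balaban1983to89.T4EtaRateCoeffDefect (fibre mem_fibre)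
open Summit.QuantumFields.YangMills.BalabanUVNodes.N15.DefectKernel (hasMaj_ofBlocks_of_rowSum entry_le_of_hasMaj)

variable {g : B6.Geometry}

/-! ## §1 Entries ⟺ block rows for `Matrix.mulVecLin`, sharp in both directions -/

section Entries

variable {X X₂ : Type} [Fintype X] [Fintype X₂] [DecidableEq X]

omit [Fintype X₂] in
/-- `A.mulVecLin δ_z` is the column `z` of `A`. [folklore] -/
theorem mulVecLin_single_apply (A : Matrix X₂ X ℝ) (z : X) (x₂ : X₂) : Matrix.mulVecLin A (Pi.single z 1) x₂ = A x₂ z := by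
  rw [Matrix.mulVecLin_apply, Matrix.mulVec_single_one, Matrix.col_apply]

/-- READOUT: a block majorant of `A.mulVecLin` between sharp block norms bounds every entry, `|A x₂ z| ≤ K(blk₂ x₂, blk₁ z)`. [folklore] -/
theorem entry_le_of_hasMaj_mulVecLin (blk₁ : X → g.Site) (blk₂ : X₂ → g.Site) {A : Matrix X₂ X ℝ} {K : g.Site → g.Site → ℝ}
    (h : HasMaj (BlockNorm.ofBlocks g blk₁) (BlockNorm.ofBlocks g blk₂) (Matrix.mulVecLin A) K) (x₂ : X₂) (z : X) :
    |A x₂ z| ≤ K (blk₂ x₂) (blk₁ z) := by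
  have h1 := entry_le_of_hasMaj blk₁ blk₂ h z x₂
  rwa [mulVecLin_single_apply] at h1

omit [DecidableEq X] in
/-- ★ **THE SHARP CONVERSE**: a block majorant `K ≥ 0` of `A.mulVecLin` bounds the block ROW SUMS, `Σ_{z ∈ blk₁⁻¹y′} |A x₂ z| ≤ K(blk₂ x₂, y′)` — test the majorant against the sign
pattern of the row `x₂` on the block `y′` (sup size `≤ 1`). [folklore] -/
theorem sum_abs_le_of_hasMaj_mulVecLin [DecidableEq g.Site] (blk₁ : X → g.Site) (blk₂ : X₂ → g.Site) {A : Matrix X₂ X ℝ} {K : g.Site → g.Site → ℝ}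
    (hK : ∀ y y', 0 ≤ K y y') (h : HasMaj (BlockNorm.ofBlocks g blk₁) (BlockNorm.ofBlocks g blk₂) (Matrix.mulVecLin A) K) (x₂ : X₂) (y' : g.Site) :
    ∑ z ∈ fibre blk₁ y', |A x₂ z| ≤ K (blk₂ x₂) y' := by
  classical
  -- the sign pattern of the row on the block
  set s : X → ℝ := fun z => if blk₁ z = y' then (if 0 ≤ A x₂ z then 1 else -1) else 0 with hs
  have hloc : (BlockNorm.ofBlocks g blk₁).IsLoc y' s := by
    intro z hz
    simp [hs, hz]
  have hsize : (BlockNorm.ofBlocks g blk₁).loc y' s ≤ 1 :=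
    loc_ofBlocks_le blk₁ s zero_le_one fun z _ => by
      simp only [hs]
      split_ifs <;> simp
  have hrow := h y' s hloc (blk₂ x₂)
  have habs : |Matrix.mulVecLin A s x₂| ≤ K (blk₂ x₂) y' :=
    (abs_le_loc_ofBlocks blk₂ (Matrix.mulVecLin A s) rfl).trans (hrow.trans (by
      calc K (blk₂ x₂) y' * (BlockNorm.ofBlocks g blk₁).loc y' s ≤ K (blk₂ x₂) y' * 1 := mul_le_mul_of_nonneg_left hsize (hK _ _)
        _ = K (blk₂ x₂) y' := mul_one _))
  -- the tested value IS the row sum of absolute values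
  have hval : Matrix.mulVecLin A s x₂ = ∑ z ∈ fibre blk₁ y', |A x₂ z| := by
    rw [Matrix.mulVecLin_apply, Matrix.mulVec, dotProduct]
    rw [fibre, Finset.sum_filter]
    refine Finset.sum_congr rfl fun z _ => ?_
    simp only [hs]
    split_ifs with hz hpos
    · rw [mul_one, abs_of_nonneg hpos]
    · rw [mul_neg_one, abs_of_neg (lt_of_not_ge hpos)]
    · rw [mul_zero]
  rw [hval] at habs
  exact (le_abs_self _).trans habs

omit [DecidableEq X] in
/-- REDUCTION (row sums ⇒ majorant) for `A.mulVecLin` (this seat's part 1 `hasMaj_ofBlocks_of_rowSum` read for matrices). [folklore] -/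
theorem hasMaj_mulVecLin_of_sum_abs_le [DecidableEq X] [DecidableEq g.Site] (blk₁ : X → g.Site) (blk₂ : X₂ → g.Site) {A : Matrix X₂ X ℝ} {K : g.Site → g.Site → ℝ}
    (hK : ∀ y y', 0 ≤ K y y') (h : ∀ (x₂ : X₂) (y' : g.Site), ∑ z ∈ fibre blk₁ y', |A x₂ z| ≤ K (blk₂ x₂) y') :
    HasMaj (BlockNorm.ofBlocks g blk₁) (BlockNorm.ofBlocks g blk₂) (Matrix.mulVecLin A) K :=
  hasMaj_ofBlocks_of_rowSum blk₁ blk₂ hK fun x₂ y' => by simpa only [mulVecLin_single_apply] using h x₂ y'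

/-- COLUMN block sums: `Σ_{x₂ ∈ blk₂⁻¹z′} |A x₂ z| ≤ N·K(z′, blk₁ z)` when the blocks of `blk₂` hold at most `N` points (each entry `≤ K`). [folklore] -/
theorem sum_fibre_abs_le_card_mul [DecidableEq g.Site] (blk₁ : X → g.Site) (blk₂ : X₂ → g.Site) {A : Matrix X₂ X ℝ} {K : g.Site → g.Site → ℝ} {N : ℕ}
    (hK : ∀ y y', 0 ≤ K y y') (hN : ∀ z', (fibre blk₂ z').card ≤ N) (h : HasMaj (BlockNorm.ofBlocks g blk₁) (BlockNorm.ofBlocks g blk₂) (Matrix.mulVecLin A) K)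
    (z' : g.Site) (z : X) : ∑ x₂ ∈ fibre blk₂ z', |A x₂ z| ≤ N * K z' (blk₁ z) := by
  calc ∑ x₂ ∈ fibre blk₂ z', |A x₂ z| ≤ ∑ x₂ ∈ fibre blk₂ z', K z' (blk₁ z) := Finset.sum_le_sum fun x₂ hx₂ => by
          have hx : blk₂ x₂ = z' := (mem_fibre blk₂ z' x₂).1 hx₂
          simpa only [hx] using entry_le_of_hasMaj_mulVecLin blk₁ blk₂ h x₂ z
    _ = (fibre blk₂ z').card * K z' (blk₁ z) := by rw [Finset.sum_const, nsmul_eq_mul]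
    _ ≤ N * K z' (blk₁ z) := mul_le_mul_of_nonneg_right (by exact_mod_cast hN z') (hK _ _)

omit [Fintype X] [DecidableEq X] in
/-- Sums over a lattice regrouped by blocks, with non-negative block-constant summands: `Σ_y f(blk y) ≤ N_Y·Σ_w f(w)`. [folklore] -/
theorem sum_comp_blk_le_card_mul_sum [DecidableEq g.Site] (blk : X₂ → g.Site) {N : ℕ} (hN : ∀ w, (fibre blk w).card ≤ N) (f : g.Site → ℝ) (hf : ∀ w, 0 ≤ f w) :
    ∑ y : X₂, f (blk y) ≤ N * ∑ w : g.Site, f w := by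
  classical
  have hfib : ∀ y : X₂, y ∈ fibre blk (blk y) := fun y => (mem_fibre blk _ y).2 rfl
  calc ∑ y : X₂, f (blk y) = ∑ w : g.Site, ∑ y ∈ fibre blk w, f (blk y) := by
          rw [← Finset.sum_fiberwise_of_maps_to (s := Finset.univ) (t := Finset.univ) (g := blk) (fun y _ => Finset.mem_univ _)]
          refine Finset.sum_congr rfl fun w _ => Finset.sum_congr ?_ fun _ _ => rfl
          ext y; simp [fibre]
    _ = ∑ w : g.Site, (fibre blk w).card * f w := Finset.sum_congr rfl fun w _ => by
          rw [Finset.sum_congr rfl fun y hy => by rw [(mem_fibre blk w y).1 hy], Finset.sum_const, nsmul_eq_mul]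
    _ ≤ ∑ w : g.Site, N * f w := Finset.sum_le_sum fun w _ => mul_le_mul_of_nonneg_right (by exact_mod_cast hN w) (hf w)
    _ = N * ∑ w : g.Site, f w := by rw [Finset.mul_sum]

end Entries

/-! ## §2 Rows of the transposed products `Aᵀ·B` and `A·C·Bᵀ` -/

section Transpose

variable {P Y : Type} [Fintype P] [Fintype Y] [DecidableEq P] [DecidableEq Y] [DecidableEq g.Site]

omit [DecidableEq P] in
/-- ★ **ROWS OF `Aᵀ·B` ON THE COARSE LATTICE** from the rows of `A, B` as kernels coarse → fine: `(w, w′) ↦ N·Σ_z K_A(z, w)·K_B(z, w′)` (`N` = fine block cardinality) — the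
coarse index of `Aᵀ` pairs with whole fine blocks, `Σ_{p ∈ B(z)} |A(p, y)| ≤ N·K_A(z, blk y)`. [folklore] -/
theorem hasMaj_transpose_mul (blkP : P → g.Site) (blkY : Y → g.Site) {A B : Matrix P Y ℝ} {KA KB : g.Site → g.Site → ℝ} {N : ℕ}
    (hKA : ∀ y y', 0 ≤ KA y y') (hKB : ∀ y y', 0 ≤ KB y y') (hN : ∀ z, (fibre blkP z).card ≤ N)
    (hA : HasMaj (BlockNorm.ofBlocks g blkY) (BlockNorm.ofBlocks g blkP) (Matrix.mulVecLin A) KA)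
    (hB : HasMaj (BlockNorm.ofBlocks g blkY) (BlockNorm.ofBlocks g blkP) (Matrix.mulVecLin B) KB) :
    HasMaj (BlockNorm.ofBlocks g blkY) (BlockNorm.ofBlocks g blkY) (Matrix.mulVecLin (Aᵀ * B)) (fun w w' => N * ∑ z : g.Site, KA z w * KB z w') := by
  classical
  refine hasMaj_mulVecLin_of_sum_abs_le blkY blkY (fun w w' => mul_nonneg (Nat.cast_nonneg _) (Finset.sum_nonneg fun z _ => mul_nonneg (hKA _ _) (hKB _ _)))
    fun y w' => ?_
  -- `(AᵀB) y y′ = Σ_p A p y · B p y′`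
  calc ∑ y' ∈ fibre blkY w', |(Aᵀ * B) y y'|
      = ∑ y' ∈ fibre blkY w', |∑ p, A p y * B p y'| := by simp only [Matrix.mul_apply, Matrix.transpose_apply]
    _ ≤ ∑ y' ∈ fibre blkY w', ∑ p, |A p y| * |B p y'| := Finset.sum_le_sum fun y' _ => (Finset.abs_sum_le_sum_abs _ _).trans (le_of_eq (Finset.sum_congr rfl fun p _ => abs_mul _ _))
    _ = ∑ p, |A p y| * ∑ y' ∈ fibre blkY w', |B p y'| := by rw [Finset.sum_comm]; exact Finset.sum_congr rfl fun p _ => by rw [Finset.mul_sum]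
    _ ≤ ∑ p, |A p y| * KB (blkP p) w' := Finset.sum_le_sum fun p _ => mul_le_mul_of_nonneg_left (sum_abs_le_of_hasMaj_mulVecLin blkY blkP hKB hB p w') (abs_nonneg _)
    _ ≤ ∑ p, KA (blkP p) (blkY y) * KB (blkP p) w' := Finset.sum_le_sum fun p _ => mul_le_mul_of_nonneg_right (entry_le_of_hasMaj_mulVecLin blkY blkP hA p y) (hKB _ _)
    _ ≤ N * ∑ z : g.Site, KA z (blkY y) * KB z w' := sum_comp_blk_le_card_mul_sum blkP hN (fun z => KA z (blkY y) * KB z w') fun z => mul_nonneg (hKA _ _) (hKB _ _)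

/-- ★★ **ROWS OF `A·C·Bᵀ` ON THE FINE LATTICE** from the rows of `A, B : fine ← coarse` and `C : coarse ← coarse`: `(z, z′) ↦ N·N_Y²·Σ_{w,w′} K_A(z, w)·K_C(w, w′)·K_B(z′, w′)`
(`N` = fine block cardinality bounding `Σ_{p′ ∈ B(z′)}|B(p′, y′)|`, `N_Y` = coarse block cardinality regrouping the two coarse sums) — the shape of [B9] p. 399's reading of (3.49) off
Theorems 3.1–3.2 for `DPD* = (DG′Q′*)·(Q′G′²Q′*)⁻¹·(DG′Q′*)*`. [cite: Balaban1985BackgroundPropagators, (3.49) p.399 (mechanism: «using again Lemma 2.1»)] -/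
theorem hasMaj_mul_mul_transpose (blkP : P → g.Site) (blkY : Y → g.Site) {A B : Matrix P Y ℝ} {C : Matrix Y Y ℝ} {KA KB KC : g.Site → g.Site → ℝ} {N NY : ℕ}
    (hKA : ∀ y y', 0 ≤ KA y y') (hKB : ∀ y y', 0 ≤ KB y y') (hKC : ∀ y y', 0 ≤ KC y y') (hN : ∀ z, (fibre blkP z).card ≤ N) (hNY : ∀ w, (fibre blkY w).card ≤ NY)
    (hA : HasMaj (BlockNorm.ofBlocks g blkY) (BlockNorm.ofBlocks g blkP) (Matrix.mulVecLin A) KA)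
    (hB : HasMaj (BlockNorm.ofBlocks g blkY) (BlockNorm.ofBlocks g blkP) (Matrix.mulVecLin B) KB)
    (hC : HasMaj (BlockNorm.ofBlocks g blkY) (BlockNorm.ofBlocks g blkY) (Matrix.mulVecLin C) KC) :
    HasMaj (BlockNorm.ofBlocks g blkP) (BlockNorm.ofBlocks g blkP) (Matrix.mulVecLin (A * C * Bᵀ))
      (fun z z' => N * NY * NY * ∑ w : g.Site, ∑ w' : g.Site, KA z w * KC w w' * KB z' w') := by
  classical
  have hS0 : ∀ z z', 0 ≤ ∑ w : g.Site, ∑ w' : g.Site, KA z w * KC w w' * KB z' w' := fun z z' =>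
    Finset.sum_nonneg fun w _ => Finset.sum_nonneg fun w' _ => mul_nonneg (mul_nonneg (hKA _ _) (hKC _ _)) (hKB _ _)
  refine hasMaj_mulVecLin_of_sum_abs_le blkP blkP (fun z z' => mul_nonneg (by positivity) (hS0 z z')) fun p z' => ?_
  set z : g.Site := blkP p with hz
  -- expand the product and push the absolute value inside
  have hexp : ∀ p' : P, |(A * C * Bᵀ) p p'| ≤ ∑ y, ∑ y', |A p y| * |C y y'| * |B p' y'| := by
    intro p'
    rw [Matrix.mul_apply]
    refine (Finset.abs_sum_le_sum_abs _ _).trans ?_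
    -- `Σ_{y′} |(AC) p y′ · Bᵀ y′ p′| ≤ Σ_{y′} Σ_y |A p y||C y y′||B p′ y′|`
    calc ∑ y', |(A * C) p y' * Bᵀ y' p'| = ∑ y', |∑ y, A p y * C y y'| * |B p' y'| := Finset.sum_congr rfl fun y' _ => by rw [abs_mul, Matrix.mul_apply, Matrix.transpose_apply]
      _ ≤ ∑ y', (∑ y, |A p y| * |C y y'|) * |B p' y'| := Finset.sum_le_sum fun y' _ =>
          mul_le_mul_of_nonneg_right ((Finset.abs_sum_le_sum_abs _ _).trans (le_of_eq (Finset.sum_congr rfl fun y _ => abs_mul _ _))) (abs_nonneg _)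
      _ = ∑ y, ∑ y', |A p y| * |C y y'| * |B p' y'| := by
          rw [Finset.sum_comm]
          exact Finset.sum_congr rfl fun y' _ => by rw [Finset.sum_mul]
  calc ∑ p' ∈ fibre blkP z', |(A * C * Bᵀ) p p'|
      ≤ ∑ p' ∈ fibre blkP z', ∑ y, ∑ y', |A p y| * |C y y'| * |B p' y'| := Finset.sum_le_sum fun p' _ => hexp p'
    _ = ∑ y, ∑ y', |A p y| * |C y y'| * ∑ p' ∈ fibre blkP z', |B p' y'| := by
        rw [Finset.sum_comm]
        refine Finset.sum_congr rfl fun y _ => ?_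
        rw [Finset.sum_comm]
        exact Finset.sum_congr rfl fun y' _ => by rw [Finset.mul_sum]
    _ ≤ ∑ y, ∑ y', KA z (blkY y) * KC (blkY y) (blkY y') * (N * KB z' (blkY y')) := Finset.sum_le_sum fun y _ => Finset.sum_le_sum fun y' _ => by
        have h1 : |A p y| ≤ KA z (blkY y) := entry_le_of_hasMaj_mulVecLin blkY blkP hA p y
        have h2 : |C y y'| ≤ KC (blkY y) (blkY y') := entry_le_of_hasMaj_mulVecLin blkY blkY hC y y'
        have h3 : ∑ p' ∈ fibre blkP z', |B p' y'| ≤ N * KB z' (blkY y') := sum_fibre_abs_le_card_mul blkY blkP hKB hN hB z' y'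
        have h12 : |A p y| * |C y y'| ≤ KA z (blkY y) * KC (blkY y) (blkY y') := mul_le_mul h1 h2 (abs_nonneg _) (hKA _ _)
        exact mul_le_mul h12 h3 (Finset.sum_nonneg fun _ _ => abs_nonneg _) (mul_nonneg (hKA _ _) (hKC _ _))
    _ = N * ∑ y, ∑ y', KA z (blkY y) * KC (blkY y) (blkY y') * KB z' (blkY y') := by
        rw [Finset.mul_sum]
        refine Finset.sum_congr rfl fun y _ => ?_
        rw [Finset.mul_sum]
        exact Finset.sum_congr rfl fun y' _ => by ring
    _ ≤ N * (NY * ∑ w, ∑ y', KA z w * KC w (blkY y') * KB z' (blkY y')) := by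
        refine mul_le_mul_of_nonneg_left ?_ (Nat.cast_nonneg _)
        exact sum_comp_blk_le_card_mul_sum blkY hNY (fun w => ∑ y', KA z w * KC w (blkY y') * KB z' (blkY y'))
          fun w => Finset.sum_nonneg fun y' _ => mul_nonneg (mul_nonneg (hKA _ _) (hKC _ _)) (hKB _ _)
    _ ≤ N * (NY * ∑ w, (NY * ∑ w', KA z w * KC w w' * KB z' w')) := by
        refine mul_le_mul_of_nonneg_left (mul_le_mul_of_nonneg_left (Finset.sum_le_sum fun w _ => ?_) (Nat.cast_nonneg _)) (Nat.cast_nonneg _)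
        exact sum_comp_blk_le_card_mul_sum blkY hNY (fun w' => KA z w * KC w w' * KB z' w') fun w' => mul_nonneg (mul_nonneg (hKA _ _) (hKC _ _)) (hKB _ _)
    _ = N * NY * NY * ∑ w, ∑ w', KA z w * KC w w' * KB z' w' := by
        rw [← Finset.mul_sum]
        ring

end Transpose

/-! ## §3 Exponential kernels -/

section Exp

variable {P Y : Type} [Fintype P] [Fintype Y] [DecidableEq P] [DecidableEq Y] [DecidableEq g.Site]

omit [DecidableEq g.Site] in
/-- The two-kernel convolution with a symmetric distance: `Σ_z e^{−δd(z,w)}e^{−δd(z,w′)} ≤ c·e^{−(δ−σ)d(w,w′)}` (`0 < σ ≤ δ`). [cite: Balaban1984PropagatorsII, (2.54)–(2.56) pp.232–233, Lemma 2.1 (2.61) p.234] -/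
theorem conv_exp_symm_le {δ σ c : ℝ} (htri : Triangle254 g) (hd : ∀ a b : g.Site, 0 ≤ g.dist a b) (hsymm : ∀ a b : g.Site, g.dist a b = g.dist b a)
    (hrow : RowSum g σ c) (hσ : 0 < σ) (hσδ : σ ≤ δ) (w w' : g.Site) :
    ∑ z : g.Site, Real.exp (-(δ * g.dist z w)) * Real.exp (-(δ * g.dist z w')) ≤ c * Real.exp (-((δ - σ) * g.dist w w')) := by
  have h := conv_exp_le (ρ₁ := δ) (ρ₂ := δ) (ρ := δ - σ) htri hd hrow (by linarith) (by linarith) (by linarith) w w'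
  refine le_trans (le_of_eq (Finset.sum_congr rfl fun z _ => by rw [hsymm z w])) h

omit [DecidableEq g.Site] in
/-- The three-kernel convolution of `A·C·Bᵀ`: `Σ_{w,w′} e^{−δd(z,w)}e^{−δd(w,w′)}e^{−δd(z′,w′)} ≤ c²·e^{−(δ−σ)d(z,z′)}` (`0 < σ ≤ δ`). [cite: Balaban1984PropagatorsII, (2.54)–(2.56) pp.232–233, Lemma 2.1 (2.61) p.234] -/
theorem conv3_exp_le {δ σ c : ℝ} (htri : Triangle254 g) (hd : ∀ a b : g.Site, 0 ≤ g.dist a b) (hsymm : ∀ a b : g.Site, g.dist a b = g.dist b a)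
    (hrow : RowSum g σ c) (hσ : 0 < σ) (hσδ : σ ≤ δ) (z z' : g.Site) :
    ∑ w : g.Site, ∑ w' : g.Site, Real.exp (-(δ * g.dist z w)) * Real.exp (-(δ * g.dist w w')) * Real.exp (-(δ * g.dist z' w'))
      ≤ c * c * Real.exp (-((δ - σ) * g.dist z z')) := by
  have hc : 0 ≤ c ∨ IsEmpty g.Site := by
    by_cases hne : Nonempty g.Site
    · exact Or.inl (hrow.nonneg (Classical.arbitrary _))
    · exact Or.inr (not_nonempty_iff.mp hne)
  rcases hc with hc | hemp
  swap
  · exact (IsEmpty.false z).elim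
  -- inner convolution in `w′`
  have hinner : ∀ w : g.Site, ∑ w' : g.Site, Real.exp (-(δ * g.dist z w)) * Real.exp (-(δ * g.dist w w')) * Real.exp (-(δ * g.dist z' w'))
      ≤ Real.exp (-(δ * g.dist z w)) * (c * Real.exp (-((δ - σ) * g.dist w z'))) := by
    intro w
    have h := conv_exp_le (ρ₁ := δ) (ρ₂ := δ) (ρ := δ - σ) htri hd hrow (by linarith) (by linarith) (by linarith) w z'
    calc ∑ w' : g.Site, Real.exp (-(δ * g.dist z w)) * Real.exp (-(δ * g.dist w w')) * Real.exp (-(δ * g.dist z' w'))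
        = Real.exp (-(δ * g.dist z w)) * ∑ w' : g.Site, Real.exp (-(δ * g.dist w w')) * Real.exp (-(δ * g.dist w' z')) := by
          rw [Finset.mul_sum]
          exact Finset.sum_congr rfl fun w' _ => by rw [hsymm z' w']; ring
      _ ≤ Real.exp (-(δ * g.dist z w)) * (c * Real.exp (-((δ - σ) * g.dist w z'))) := mul_le_mul_of_nonneg_left h (Real.exp_nonneg _)
  -- outer convolution in `w`
  have houter := conv_exp_le (ρ₁ := δ) (ρ₂ := δ - σ) (ρ := δ - σ) htri hd hrow (by linarith) le_rfl (by linarith) z z'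
  calc ∑ w : g.Site, ∑ w' : g.Site, Real.exp (-(δ * g.dist z w)) * Real.exp (-(δ * g.dist w w')) * Real.exp (-(δ * g.dist z' w'))
      ≤ ∑ w : g.Site, Real.exp (-(δ * g.dist z w)) * (c * Real.exp (-((δ - σ) * g.dist w z'))) := Finset.sum_le_sum fun w _ => hinner w
    _ = c * ∑ w : g.Site, Real.exp (-(δ * g.dist z w)) * Real.exp (-((δ - σ) * g.dist w z')) := by
        rw [Finset.mul_sum]; exact Finset.sum_congr rfl fun w _ => by ring
    _ ≤ c * (c * Real.exp (-((δ - σ) * g.dist z z'))) := mul_le_mul_of_nonneg_left houter hc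
    _ = c * c * Real.exp (-((δ - σ) * g.dist z z')) := by ring

omit [DecidableEq P] in
/-- ★ `Aᵀ·B` with exponential rows: `a e^{−δd}`, `b e^{−δd}` ⟹ `N·a·b·c·e^{−(δ−σ)d}`. [cite: Balaban1984PropagatorsII, (2.52)–(2.56) pp.232–233] -/
theorem hasMaj_transpose_mul_exp (blkP : P → g.Site) (blkY : Y → g.Site) {A B : Matrix P Y ℝ} {a b δ σ c : ℝ} {N : ℕ}
    (htri : Triangle254 g) (hd : ∀ a b : g.Site, 0 ≤ g.dist a b) (hsymm : ∀ a b : g.Site, g.dist a b = g.dist b a) (hrow : RowSum g σ c) (hσ : 0 < σ) (hσδ : σ ≤ δ)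
    (ha : 0 ≤ a) (hb : 0 ≤ b) (hN : ∀ z, (fibre blkP z).card ≤ N)
    (hA : HasMaj (BlockNorm.ofBlocks g blkY) (BlockNorm.ofBlocks g blkP) (Matrix.mulVecLin A) (fun y y' => a * Real.exp (-(δ * g.dist y y'))))
    (hB : HasMaj (BlockNorm.ofBlocks g blkY) (BlockNorm.ofBlocks g blkP) (Matrix.mulVecLin B) (fun y y' => b * Real.exp (-(δ * g.dist y y')))) :
    HasMaj (BlockNorm.ofBlocks g blkY) (BlockNorm.ofBlocks g blkY) (Matrix.mulVecLin (Aᵀ * B)) (fun w w' => N * a * b * c * Real.exp (-((δ - σ) * g.dist w w'))) := by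
  refine (hasMaj_transpose_mul blkP blkY (fun _ _ => by positivity) (fun _ _ => by positivity) hN hA hB).mono fun w w' => ?_
  have h := conv_exp_symm_le htri hd hsymm hrow hσ hσδ w w'
  calc (N : ℝ) * ∑ z : g.Site, a * Real.exp (-(δ * g.dist z w)) * (b * Real.exp (-(δ * g.dist z w')))
      = N * ((a * b) * ∑ z : g.Site, Real.exp (-(δ * g.dist z w)) * Real.exp (-(δ * g.dist z w'))) := by
        congr 1
        rw [Finset.mul_sum]
        exact Finset.sum_congr rfl fun z _ => by ring
    _ = N * (a * b) * ∑ z : g.Site, Real.exp (-(δ * g.dist z w)) * Real.exp (-(δ * g.dist z w')) := by ring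
    _ ≤ N * (a * b) * (c * Real.exp (-((δ - σ) * g.dist w w'))) := mul_le_mul_of_nonneg_left h (by positivity)
    _ = N * a * b * c * Real.exp (-((δ - σ) * g.dist w w')) := by ring

/-- ★★ **`A·C·Bᵀ` WITH EXPONENTIAL ROWS**: `a e^{−δd}` (A), `γ e^{−δd}` (C), `b e^{−δd}` (B) ⟹ `N·N_Y²·a·γ·b·c²·e^{−(δ−σ)d}` — the shape of (3.49) read off (3.42) and (3.48).
[cite: Balaban1985BackgroundPropagators, (3.49) p.399 (mechanism); Balaban1984PropagatorsII, (2.52)–(2.56) pp.232–233] -/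
theorem hasMaj_mul_mul_transpose_exp (blkP : P → g.Site) (blkY : Y → g.Site) {A B : Matrix P Y ℝ} {C : Matrix Y Y ℝ} {a b γ δ σ c : ℝ} {N NY : ℕ}
    (htri : Triangle254 g) (hd : ∀ a b : g.Site, 0 ≤ g.dist a b) (hsymm : ∀ a b : g.Site, g.dist a b = g.dist b a) (hrow : RowSum g σ c) (hσ : 0 < σ) (hσδ : σ ≤ δ)
    (ha : 0 ≤ a) (hb : 0 ≤ b) (hγ : 0 ≤ γ) (hN : ∀ z, (fibre blkP z).card ≤ N) (hNY : ∀ w, (fibre blkY w).card ≤ NY)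
    (hA : HasMaj (BlockNorm.ofBlocks g blkY) (BlockNorm.ofBlocks g blkP) (Matrix.mulVecLin A) (fun y y' => a * Real.exp (-(δ * g.dist y y'))))
    (hB : HasMaj (BlockNorm.ofBlocks g blkY) (BlockNorm.ofBlocks g blkP) (Matrix.mulVecLin B) (fun y y' => b * Real.exp (-(δ * g.dist y y'))))
    (hC : HasMaj (BlockNorm.ofBlocks g blkY) (BlockNorm.ofBlocks g blkY) (Matrix.mulVecLin C) (fun y y' => γ * Real.exp (-(δ * g.dist y y')))) :
    HasMaj (BlockNorm.ofBlocks g blkP) (BlockNorm.ofBlocks g blkP) (Matrix.mulVecLin (A * C * Bᵀ))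
      (fun z z' => N * NY * NY * a * γ * b * (c * c) * Real.exp (-((δ - σ) * g.dist z z'))) := by
  refine (hasMaj_mul_mul_transpose blkP blkY (fun _ _ => by positivity) (fun _ _ => by positivity) (fun _ _ => by positivity) hN hNY hA hB hC).mono fun z z' => ?_
  have h := conv3_exp_le htri hd hsymm hrow hσ hσδ z z'
  calc (N : ℝ) * NY * NY * ∑ w : g.Site, ∑ w' : g.Site, a * Real.exp (-(δ * g.dist z w)) * (γ * Real.exp (-(δ * g.dist w w'))) * (b * Real.exp (-(δ * g.dist z' w')))
      = N * NY * NY * ((a * γ * b) * ∑ w : g.Site, ∑ w' : g.Site, Real.exp (-(δ * g.dist z w)) * Real.exp (-(δ * g.dist w w')) * Real.exp (-(δ * g.dist z' w'))) := by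
        congr 1
        rw [Finset.mul_sum]
        refine Finset.sum_congr rfl fun w _ => ?_
        rw [Finset.mul_sum]
        exact Finset.sum_congr rfl fun w' _ => by ring
    _ = N * NY * NY * (a * γ * b) * ∑ w : g.Site, ∑ w' : g.Site, Real.exp (-(δ * g.dist z w)) * Real.exp (-(δ * g.dist w w')) * Real.exp (-(δ * g.dist z' w')) := by ring
    _ ≤ N * NY * NY * (a * γ * b) * (c * c * Real.exp (-((δ - σ) * g.dist z z'))) := mul_le_mul_of_nonneg_left h (by positivity)
    _ = N * NY * NY * a * γ * b * (c * c) * Real.exp (-((δ - σ) * g.dist z z')) := by ring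

end Exp

/-! ## §4 Composition with block-local factors -/

section Local

variable {F₁ F₂ F₃ : Type} [AddCommGroup F₁] [Module ℝ F₁] [AddCommGroup F₂] [Module ℝ F₂] [AddCommGroup F₃] [Module ℝ F₃] [DecidableEq g.Site]

/-- Composition with a block-LOCAL factor on the right (majorant `𝟙[y = y′]·m`): the kernel of the left factor is read at the same block, times `κ₂·m` — no row sum, no rate loss. [folklore] -/
theorem hasMaj_comp_localRight {b₁ : BlockNorm g F₁} {b₂ : BlockNorm g F₂} {b₃ : BlockNorm g F₃} {T₁ : F₂ →ₗ[ℝ] F₃} {T₂ : F₁ →ₗ[ℝ] F₂} {K₁ : g.Site → g.Site → ℝ} {m : ℝ}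
    (h₁ : HasMaj b₂ b₃ T₁ K₁) (h₂ : HasMaj b₁ b₂ T₂ (fun y y' => if y = y' then m else 0)) (hK₁ : ∀ a b, 0 ≤ K₁ a b) :
    HasMaj b₁ b₃ (T₁ ∘ₗ T₂) (fun a b => K₁ a b * (b₂.κ * m)) := by
  refine (hasMaj_comp h₁ h₂ hK₁).mono fun a b => le_of_eq ?_
  simp only [mul_ite, mul_zero]
  rw [Finset.sum_ite_eq' Finset.univ b]
  simp

/-- Composition with a block-LOCAL factor on the left. [folklore] -/
theorem hasMaj_comp_localLeft {b₁ : BlockNorm g F₁} {b₂ : BlockNorm g F₂} {b₃ : BlockNorm g F₃} {T₁ : F₂ →ₗ[ℝ] F₃} {T₂ : F₁ →ₗ[ℝ] F₂} {K₂ : g.Site → g.Site → ℝ} {m : ℝ}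
    (hm : 0 ≤ m) (h₁ : HasMaj b₂ b₃ T₁ (fun y y' => if y = y' then m else 0)) (h₂ : HasMaj b₁ b₂ T₂ K₂) :
    HasMaj b₁ b₃ (T₁ ∘ₗ T₂) (fun a b => m * (b₂.κ * K₂ a b)) := by
  refine (hasMaj_comp h₁ h₂ fun a b => by split_ifs <;> simp [hm]).mono fun a b => le_of_eq ?_
  simp only [ite_mul, zero_mul]
  rw [Finset.sum_ite_eq Finset.univ a]
  simp

omit [DecidableEq g.Site] in
/-- A block-diagonal majorant is an exponential one at any rate: `𝟙[y = y′]·m ≤ m·e^{−ρ·d(y,y′)}` when `d(y,y) = 0` and `m ≥ 0`. [folklore] -/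
theorem indicator_le_exp [DecidableEq g.Site] {m ρ : ℝ} (hm : 0 ≤ m) (hself : ∀ y : g.Site, g.dist y y = 0) (y y' : g.Site) :
    (if y = y' then m else 0) ≤ m * Real.exp (-(ρ * g.dist y y')) := by
  split_ifs with h
  · subst h; rw [hself, mul_zero, neg_zero, Real.exp_zero, mul_one]
  · positivity

end Local

end Summit.QuantumFields.YangMills.BalabanUVNodes.N15.BlockRows

end
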